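import Literature.IUT.LogVolume.DHProbabilisticSzpiroTermIV
import Literature.IUT.LogVolume.DHExplicitSzpiro
import HarnessLib

/-!
# Dupuy–Hilado (arXiv:2004.13108v2) §7.6 (7.6) PROVED and §7.12 (7.15) ASSEMBLED from (7.4) with the
# constants the printed chain supports — Probabilistic Szpiro, corrected bookkeeping

PROOF-ONLY sequel of `DHProbabilisticSzpiroTerms` / `DHProbabilisticSzpiroTermIV` over the typed candidates of
`DHProbabilisticSzpiro` and `DHExplicitSzpiro` (T. Dupuy, A. Hilado, arXiv:2004.13108v2 [DupuyHilado2020];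
held render `book:anonnd-2004-13108v2`, locators `p.N l.M`). What is PROVED:

* **(7.6)** p.24 l.35–82, "`I = Σ_p E²_p(ord_p(q_{v_j}^{j²})) = … = deĝ_{lgp,F₀}(P_Θ)`" (with the sign and
  normalisation of the typed `termI`): `sumTermIEq_holds` — the candidate `SumTermIEq X T` holds for every
  set `T` of primes (coordinate marginal §7.3, the averaging identity of [DupuyHilado2025] Thm 3.10.1 in the
  form `ln|κ(v)| = f_v ln p`, `Pr(v) = e_v f_v/[F₀:ℚ]`, and grouping the places by residue characteristic,
  `sum_placesOver_eq_sum_S`); `termI_eq` is `I_p` in closed form.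
* **The display p.28 l.1–17 of the proof of Thm 7.12.1, with the constants the chain yields**
  (`ineq715_core`): from (7.4) (`Ineq74` — the ONLY entrance of [IUTchIII] Cor. 3.12 and Claim 5.0.1, a
  typed hypothesis), for `T` a set of primes containing the residue characteristics of the bad places and
  `bad ⇒ ramified` (p.22 l.24),
  `(deĝ̲_lgp-weight − 1)·deĝ̲(P_q) ≤ ((l+1)/4) ln Diff + Σ_p (1 − P_{unr,p}^{(l+1)/2}) ln p + ((l+5)/4)(Σ_p ln e_p + ln π)`,
  using `E2_radiusLn_le` ((7.5) corrected), `boundII_holds`, `boundIII_holds`, `boundV_holds`,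
  `sumTermIEq_holds`, `E2arch_archRadiusLn`, `PilotData.degLgp_thetaPilot`.
* **(7.15) = (1.5) corrected** (`probabilisticSzpiro_corrected`): dividing by `(l+5)/4` and using the
  "simple computation" `szpiroCoeff_eq` (p.28 l.40–53) and (3.3),
  `(1/(6+ε_l))·deĝ̲(𝔮) ≤ ln Diff(V̲/ℚ) + Σ_p ln(e_p) + [ln π + (4/(l+5))·Σ_p (1 − P_{unr,p}^{(l+1)/2})·ln p]`,
  where `deĝ̲(𝔮) = 2l·deĝ̲(P_q)` is the left side of the typed `ProbabilisticSzpiroIneq` (by (3.2),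
  `PilotDegreeFormula`, it is `ln|Δ^min_{E/F}|/[F:ℚ]`). AS PRINTED the bracket is
  `A_{l,V} = ln π + Σ_p (1 − P_{unr,p}^{(l+1)/2})(ln(b_p) + 5/(l+4))` (`archConst`); the difference is exactly
  the two print-level slips certified in `DHProbabilisticSzpiroTermIV` ((7.12) sign: no `ln(b_p)` credit;
  (7.5) floor: `ln p` in place of `1`, of which print's `5/(l+4) ≥ 4/(l+5)` absorbs nothing for `p ≥ 3`).

HONEST FRAMING: `probabilisticSzpiro_corrected` is `Ineq74 → (corrected 7.15)` — a theorem ABOUT the typed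
hypothesis template; (7.4) is the authors' reading of the disputed [IUTchIII] Cor. 3.12
[claim: Mochizuki2012, status: disputed] plus Lemma 6.3.1/Claim 5.0.1 [claim: DupuyHilado2020, status:
under-review] and is NOT asserted anywhere. Nothing is claimed about the truth of the printed Thm 1.0.3 /
`ProbabilisticSzpiroClaim`, only about what its printed derivation supports. Typed ≠ proved ≠ endorsed; no
side is taken on any author; no abc claim.
-/

noncomputable section

namespace Literature.IUT.LogVolume

open NumberField IsDedekindDomain Finset

namespace ExplicitSzpiro

variable {F₀ : Type*} [Field F₀] [NumberField F₀] (X : PilotData F₀) (R : SectionRamification F₀)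

/-! ## §7 (7.6): `Σ_p I_p = −deĝ̲_lgp(P_Θ)` -/

/-- `Σ_{i<n} (i+1)² = n(n+1)(2n+1)/6` over `ℝ` — the average of the weights `j²` of the theta pilot
("`deĝ_lgp(P_Θ) = ((l+1)l/12)·deĝ(P_q)`", p.28 l.18–19; [DupuyHilado2025] (3.3)). [cite: DupuyHilado2020, §7.12 p.28 l.18–19] -/
theorem sum_fin_succ_sq (n : ℕ) :
    ∑ i : Fin n, ((((i : ℕ) : ℝ) + 1)) ^ 2 = (n : ℝ) * (n + 1) * (2 * n + 1) / 6 := by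
  have key : ∀ m : ℕ, ∑ i ∈ Finset.range m, ((((i : ℕ) : ℝ) + 1)) ^ 2 = (m : ℝ) * (m + 1) * (2 * m + 1) / 6 := by
    intro m
    induction m with
    | zero => simp
    | succ m ih => rw [Finset.sum_range_succ, ih]; push_cast; ring
  rw [Fin.sum_univ_eq_sum_range (fun i => (((i : ℝ) + 1)) ^ 2) n, key]

/-- Grouping the finite places by residue characteristic: for a set `T` of primes containing the residue
characteristics of `S`, a function vanishing off `S` sums over `⋃_{p∈T} V(F₀)_p` to its sum over `S` (the step
"`Σ_p E(…) = deĝ(Σ_{v bad} …)`" of (7.6), p.24 l.55–82). [cite: DupuyHilado2020, (7.6) p.24 l.55–82] -/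
theorem sum_placesOver_eq_sum_S (T : Finset ℕ) (hT : ∀ p ∈ T, p.Prime)
    (hS : ∀ v ∈ X.S, residueChar F₀ v ∈ T) (g : HeightOneSpectrum (𝓞 F₀) → ℝ)
    (hg : ∀ v, v ∉ X.S → g v = 0) :
    ∑ p ∈ T, ∑ v ∈ placesOver F₀ p, g v = ∑ v ∈ X.S, g v := by
  classical
  have hdisj : (T : Set ℕ).PairwiseDisjoint (placesOver F₀) := by
    intro p hp q hq hpq
    haveI : Fact p.Prime := ⟨hT p hp⟩
    haveI : Fact q.Prime := ⟨hT q hq⟩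
    rw [Function.onFun, Finset.disjoint_left]
    intro v hvp hvq
    rw [mem_placesOver_iff_residueChar] at hvp hvq
    exact hpq (hvp.symm.trans hvq)
  rw [← Finset.sum_biUnion hdisj]
  symm
  apply Finset.sum_subset
  · intro v hv
    rw [Finset.mem_biUnion]
    refine ⟨residueChar F₀ v, hS v hv, ?_⟩
    haveI : Fact (residueChar F₀ v).Prime := ⟨residueChar_prime F₀ v⟩
    exact (mem_placesOver_iff_residueChar v).mpr rfl
  · intro v _ hv
    exact hg v hv

/-- `I_p` evaluated (prime `p`; §7.6 p.24 l.36–60, with the normalised degree):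
`I_p = −(E_j(j²)/[F₀:ℚ])·Σ_{v ∈ V(F₀)_p} P_q(v)·ln|κ(v)|`. [cite: DupuyHilado2020, (7.6) p.24 l.35–60] -/
theorem termI_eq (p : ℕ) [Fact p.Prime] :
    termI X p = -(((1 / (X.lstar : ℝ)) * ∑ i : Fin X.lstar, ((((i : ℕ) : ℝ) + 1)) ^ 2) /
      Module.finrank ℚ F₀ * ∑ v ∈ placesOver F₀ p, X.qPilot v * logNorm F₀ v) := by
  have hF : (Module.finrank ℚ F₀ : ℝ) ≠ 0 := by exact_mod_cast Module.finrank_pos.ne'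
  have h : ∀ i : Fin X.lstar, ∑ e : Fin ((i : ℕ) + 1 + 1) → placesOver F₀ p,
      ordpA X ((i : ℕ) + 1) (e (Fin.last ((i : ℕ) + 1))).1 * Real.log p * ∏ k, weight F₀ (e k).1 =
        ((((i : ℕ) : ℝ) + 1)) ^ 2 / Module.finrank ℚ F₀ *
          ∑ v ∈ placesOver F₀ p, X.qPilot v * logNorm F₀ v := by
    intro i
    rw [sum_tuple_coord' p ((i : ℕ) + 1) (Fin.last _) (fun v => ordpA X ((i : ℕ) + 1) v * Real.log p),
      Finset.mul_sum]
    refine Finset.sum_congr rfl fun v hv => ?_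
    rw [mem_placesOver_iff_residueChar] at hv
    have he : (ramIdx F₀ v : ℝ) ≠ 0 := by exact_mod_cast ramIdx_ne_zero F₀ v
    unfold ordpA weight localDegree
    rw [logNorm_eq, hv]
    push_cast
    field_simp
  unfold termI E2
  rw [Finset.sum_congr rfl fun i _ => h i, ← Finset.sum_mul, ← Finset.sum_div]
  ring

/-- **(7.6)** PROVED for a set `T` of primes: `Σ_{p∈T} I_p = −deĝ̲_lgp(P_Θ)` whenever `T` contains the residue
characteristics of the bad places (the typed candidate `SumTermIEq`, discharged). [cite: DupuyHilado2020, (7.6) p.24 l.35–82] -/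
theorem sumTermIEq_holds (T : Finset ℕ) (hT : ∀ p ∈ T, p.Prime) : SumTermIEq X T := by
  intro hS
  have hF : (Module.finrank ℚ F₀ : ℝ) ≠ 0 := by exact_mod_cast Module.finrank_pos.ne'
  have hl2 := X.two_le_lstar
  have hl : (X.lstar : ℝ) ≠ 0 := by exact_mod_cast (by omega : X.lstar ≠ 0)
  have hdeg : ∑ v ∈ X.S, X.qPilot v * logNorm F₀ v = FinDivisor.deg F₀ X.qPilot := by
    rw [show FinDivisor.deg F₀ X.qPilot = ∑ v ∈ X.S, ((X.ordq v : ℝ) / (2 * X.l)) * logNorm F₀ v from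
      FinDivisor.deg_sum_of X.S id _]
    exact Finset.sum_congr rfl fun v hv => by rw [PilotData.qPilot_apply, if_pos hv]
  have h1 : ∑ p ∈ T, termI X p =
      ∑ p ∈ T, -(((1 / (X.lstar : ℝ)) * ∑ i : Fin X.lstar, ((((i : ℕ) : ℝ) + 1)) ^ 2) /
        Module.finrank ℚ F₀ * ∑ v ∈ placesOver F₀ p, X.qPilot v * logNorm F₀ v) := by
    refine Finset.sum_congr rfl fun p hp => ?_
    haveI : Fact p.Prime := ⟨hT p hp⟩
    exact termI_eq X p
  rw [h1, Finset.sum_neg_distrib, ← Finset.mul_sum,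
    sum_placesOver_eq_sum_S X T hT hS (fun v => X.qPilot v * logNorm F₀ v)
      (fun v hv => by rw [PilotData.qPilot_apply, if_neg hv, zero_mul]),
    hdeg, LgpDivisor.ndegLgp_eq, PilotData.degLgp_thetaPilot, sum_fin_succ_sq]
  field_simp


/-! ## §8 (7.15) corrected: Probabilistic Szpiro from (7.4), with the constants the argument supports -/

/-- `deĝ̲_lgp(P_Θ) = ((ℓ⋆+1)(2ℓ⋆+1)/6)·deĝ̲(P_q)` (normalised form of `PilotData.degLgp_thetaPilot`; "`deĝ_lgp(P_Θ) =
((l+1)l/12)·deĝ(P_q)`", p.28 l.18–19). [cite: DupuyHilado2020, §7.12 p.28 l.18–19] -/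
theorem ndegLgp_thetaPilot :
    LgpDivisor.ndegLgp X.thetaPilot =
      (((X.lstar : ℝ) + 1) * (2 * X.lstar + 1) / 6) * FinDivisor.ndeg F₀ X.qPilot := by
  rw [LgpDivisor.ndegLgp_eq, PilotData.degLgp_thetaPilot, FinDivisor.ndeg_apply]
  ring

/-- `deĝ̲(P_q) = deĝ̲(𝔮)/(2l)` ("`deĝ(P_q) = ln|Δ^min|/2l[F:ℚ]`", p.28 l.19–20, divisor side). [cite: DupuyHilado2020, §7.12 p.28 l.19–20] -/
theorem ndeg_qPilot :
    FinDivisor.ndeg F₀ X.qPilot = (1 / (2 * (X.l : ℝ))) * FinDivisor.ndeg F₀ X.qDivisor := by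
  rw [X.qPilot_eq_smul, map_smul, smul_eq_mul]

/-- `diff_p ≥ 0` (prime `p`). [cite: DupuyHilado2020, (7.7) p.25 l.1–3] -/
theorem avgDiffExp_nonneg (p : ℕ) [Fact p.Prime] : 0 ≤ R.avgDiffExp p :=
  le_trans (Finset.sum_nonneg fun v _ => mul_nonneg (R.diff_nonneg v) (weight_nonneg F₀ v))
    (expect_diff_le_avgDiffExp R p)

/-- `ln Diff(V̲/ℚ) ≥ 0` over a set of primes. [cite: DupuyHilado2020, (7.9) p.25 l.7–9] -/
theorem lnAvgDifferent_nonneg (T : Finset ℕ) (hT : ∀ p ∈ T, p.Prime) : 0 ≤ R.lnAvgDifferent T := by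
  unfold SectionRamification.lnAvgDifferent
  refine Finset.sum_nonneg fun p hp => ?_
  haveI : Fact p.Prime := ⟨hT p hp⟩
  exact mul_nonneg (avgDiffExp_nonneg R p) (Real.log_natCast_nonneg p)

/-- **The bookkeeping of Thm 7.12.1, CORRECTED and PROVED** (the display p.28 l.1–17 with the constants the
chain actually yields): from (7.4) (`Ineq74`, the only place where [IUTchIII] Cor. 3.12 and Claim 5.0.1
enter), for a set `T` of primes containing the residue characteristics of `S` and `bad ⇒ ramified`,
`(deĝ̲_lgp-weight − 1)·deĝ̲(P_q) ≤ ((l+1)/4)·ln Diff + Σ_p (1 − P_{unr,p}^{(l+1)/2})·ln p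
+ ((l+5)/4)·(Σ_p ln e_p + ln π)` — print's `Σ_p (1 − P^{(l+1)/2})(1 + ((l+5)/4) ln b_p)` is replaced by
`Σ_p (1 − P^{(l+1)/2})·ln p` (floor charge `ln p`; no `ln(b_p)` credit). [cite: DupuyHilado2020, Thm 7.12.1 proof p.28 l.1–17] -/
theorem ineq715_core (T : Finset ℕ) (hT : ∀ p ∈ T, p.Prime) (hS : ∀ v ∈ X.S, residueChar F₀ v ∈ T)
    (hNOS : ∀ v ∈ X.S, R.e v ≠ 1) (h74 : Ineq74 X R T) :
    ((((X.lstar : ℝ) + 1) * (2 * X.lstar + 1) / 6) - 1) * FinDivisor.ndeg F₀ X.qPilot ≤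
      (((2 * (X.lstar : ℝ) + 1) + 1) / 4) * R.lnAvgDifferent T
        + (∑ p ∈ T, (1 - R.probUnram p ^ (X.lstar + 1)) * Real.log p)
        + (((2 * (X.lstar : ℝ) + 1) + 5) / 4) *
            ((∑ p ∈ T, Real.log (R.avgRamIdx p)) + Real.log Real.pi) := by
  have hl2 := X.two_le_lstar
  have hp : ∀ p ∈ T, E2 p X.lstar (radiusLn X R p) ≤ termI X p
      + (((2 * (X.lstar : ℝ) + 1) + 1) / 4) * R.avgDiffExp p * Real.log p
      + Real.log p * (1 - R.probUnram p ^ (X.lstar + 1))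
      + (((2 * (X.lstar : ℝ) + 1) + 5) / 4) * Real.log (R.avgRamIdx p) := by
    intro p hpT
    haveI : Fact p.Prime := ⟨hT p hpT⟩
    have h1 := E2_radiusLn_le X R p hNOS
    have h2 : termII X R p ≤ _ := boundII_holds X R p
    have h3 : termIII X R p ≤ _ := boundIII_holds X R p
    have h5 : termV X R p ≤ _ := boundV_holds X R p
    have hlog : 0 ≤ Real.log p := Real.log_natCast_nonneg p
    have h3' := mul_le_mul_of_nonneg_left h3 hlog
    linarith
  have hsum := Finset.sum_le_sum hp
  have hI : ∑ p ∈ T, termI X p = -LgpDivisor.ndegLgp X.thetaPilot := sumTermIEq_holds X T hT hS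
  have harch : E2arch X.lstar archRadiusLn = (((2 * (X.lstar : ℝ) + 1) + 5) / 4) * Real.log Real.pi :=
    E2arch_archRadiusLn X.lstar (by omega)
  have eX1 : ∑ p ∈ T, (((2 * (X.lstar : ℝ) + 1) + 1) / 4) * R.avgDiffExp p * Real.log p =
      (((2 * (X.lstar : ℝ) + 1) + 1) / 4) * R.lnAvgDifferent T := by
    unfold SectionRamification.lnAvgDifferent
    rw [Finset.mul_sum]
    exact Finset.sum_congr rfl fun p _ => by ring
  have eX2 : ∑ p ∈ T, Real.log p * (1 - R.probUnram p ^ (X.lstar + 1)) =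
      ∑ p ∈ T, (1 - R.probUnram p ^ (X.lstar + 1)) * Real.log p :=
    Finset.sum_congr rfl fun p _ => by ring
  have eX3 : ∑ p ∈ T, (((2 * (X.lstar : ℝ) + 1) + 5) / 4) * Real.log (R.avgRamIdx p) =
      (((2 * (X.lstar : ℝ) + 1) + 5) / 4) * ∑ p ∈ T, Real.log (R.avgRamIdx p) := by
    rw [Finset.mul_sum]
  unfold Ineq74 at h74
  rw [harch] at h74
  rw [Finset.sum_add_distrib, Finset.sum_add_distrib, Finset.sum_add_distrib, hI, ndegLgp_thetaPilot,
    eX1, eX2, eX3] at hsum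
  rw [sub_one_mul, mul_add]
  linarith

/-- **(7.15) CORRECTED, from (7.4) alone** — Thm 7.12.1 / Thm 1.0.3 with the constants its own chain
supports, PROVED for every pilot datum `X`, section datum `R` with `bad ⇒ ramified`, and set `T` of primes
containing the residue characteristics of `S`:
`(1/(6+ε_l))·deĝ̲(𝔮) ≤ ln Diff(V̲/ℚ) + Σ_p ln(e_p) + [ln π + (4/(l+5))·Σ_p (1 − P_{unr,p}^{(l+1)/2})·ln p]`.
Compare `ProbabilisticSzpiroIneq` (AS PRINTED): there the bracket is `A_{l,V} = ln π + Σ_p (1 − P^{(l+1)/2})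
(ln(b_p) + 5/(l+4))`; the `ln(b_p)`-credit rests on the sign slip of (7.12) (`rhs712_le_termIV`,
`not_boundIV`) and the constant `1·1_ram` on the floor of Lemma 6.3.1 (`radiusLn_le_pointwise`). The H⋆
template is unchanged: everything here is downstream of `Ineq74` = the authors' reading of [IUTchIII]
Cor. 3.12 + Lemma 6.3.1/Claim 5.0.1, typed as a hypothesis and never asserted.
[cite: DupuyHilado2020, Thm 7.12.1 (7.15)–(7.16) p.27 l.33 – p.28 l.64] -/
theorem probabilisticSzpiro_corrected (T : Finset ℕ) (hT : ∀ p ∈ T, p.Prime)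
    (hS : ∀ v ∈ X.S, residueChar F₀ v ∈ T) (hNOS : ∀ v ∈ X.S, R.e v ≠ 1) (h74 : Ineq74 X R T) :
    (1 / (6 + epsProb X.l)) * FinDivisor.ndeg F₀ X.qDivisor ≤
      R.lnAvgDifferent T + (∑ p ∈ T, Real.log (R.avgRamIdx p)) +
        (Real.log Real.pi +
          (4 / ((X.l : ℝ) + 5)) * ∑ p ∈ T, (1 - R.probUnram p ^ (X.lstar + 1)) * Real.log p) := by
  have key := ineq715_core X R T hT hS hNOS h74
  have hD := lnAvgDifferent_nonneg R T hT
  have hl2 := X.two_le_lstar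
  have hL : (2 : ℝ) ≤ X.lstar := by exact_mod_cast hl2
  have h4 : 4 ≤ X.l := by have := X.five_le_l; omega
  have hcoef : 1 / (6 + epsProb X.l) =
      ((((X.lstar : ℝ) + 1) * (2 * X.lstar + 1) / 6) - 1) * (1 / (2 * (X.l : ℝ))) *
        (4 / ((X.l : ℝ) + 5)) := by
    rw [← szpiroCoeff_eq X.l h4, X.l_cast]
    ring
  rw [ndeg_qPilot, X.l_cast] at key
  rw [hcoef, X.l_cast]
  have hB : (0 : ℝ) < ((2 * (X.lstar : ℝ) + 1) + 5) / 4 := by positivity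
  refine le_of_mul_le_mul_right ?_ hB
  have e1 : ((((X.lstar : ℝ) + 1) * (2 * X.lstar + 1) / 6) - 1) * (1 / (2 * (2 * (X.lstar : ℝ) + 1))) *
        (4 / ((2 * (X.lstar : ℝ) + 1) + 5)) * FinDivisor.ndeg F₀ X.qDivisor *
          (((2 * (X.lstar : ℝ) + 1) + 5) / 4)
      = ((((X.lstar : ℝ) + 1) * (2 * X.lstar + 1) / 6) - 1) *
          ((1 / (2 * (2 * (X.lstar : ℝ) + 1))) * FinDivisor.ndeg F₀ X.qDivisor) := by
    field_simp
  have e2 : (R.lnAvgDifferent T + (∑ p ∈ T, Real.log (R.avgRamIdx p)) +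
        (Real.log Real.pi + (4 / ((2 * (X.lstar : ℝ) + 1) + 5)) *
          ∑ p ∈ T, (1 - R.probUnram p ^ (X.lstar + 1)) * Real.log p)) *
            (((2 * (X.lstar : ℝ) + 1) + 5) / 4)
      = (((2 * (X.lstar : ℝ) + 1) + 5) / 4) * R.lnAvgDifferent T
          + (∑ p ∈ T, (1 - R.probUnram p ^ (X.lstar + 1)) * Real.log p)
          + (((2 * (X.lstar : ℝ) + 1) + 5) / 4) *
              ((∑ p ∈ T, Real.log (R.avgRamIdx p)) + Real.log Real.pi) := by
    field_simp
    ring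
  rw [e1, e2]
  nlinarith [key, hD, hL]

end ExplicitSzpiro

end Literature.IUT.LogVolume

end
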